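import Mathlib
import Literature.Probability.LatticeModels.CorrelationDecayProofs
import Summits.CriticalPhenomena.Ising3DConformalLimit.Theorems.PrecisionLaplacianTwoPointSpineGlueTauberian
import HarnessLib

/-!
# TwoPointSpineGlue (route PrecisionLaplacian, item stmt-CriticalPhenomena-4805) — the Tauberian step, III:
# the limit kernel

Helper file 18.  Abstract setting of `…TwoPointSpineGlueRays` / `…Tauberian`: `G : ℤ³ → ℝ` Lipschitz at
scale (constants `C, s`), with block scaling limits around every ray, and with a lower bound
`G(z) ≥ c₀‖z‖^{-s}`.

* `latticeApprox_inv_smul_siteVec` — a lattice point at scale `M` is its own approximation: `⌊M·(x/M)⌋ = x`;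
* `tendsto_cofinite_of_rayLimits` — **uniformity in the direction**: if `N^s G(⌊Nw⌋) → k(w)` for every
  `w ≠ 0` and `k` is homogeneous of degree `-s`, then `G(x)‖x‖₂^s − k(x/‖x‖₂) → 0` at infinity on `ℤ³`
  (a finite `1/L`-net of rays on the shell `1 ≤ ‖v‖ ≤ 2`, `ray_compare` at scale, and `rayLimit_lipschitz`);
* `exists_limit_kernel` — **there is `U : ℝ³ → ℝ`, continuous and positive off `0`, homogeneous of degree
  `-s`, with `G(x)‖x‖₂^s − U(x/‖x‖₂) → 0`** (the ray limits `limUnder`, extended by `0` at the origin).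

No definitions are introduced.
-/

noncomputable section

namespace Summit.CriticalPhenomena.Ising3DConformalLimit.Theorems.SpineGlue

open Finset Real Filter Topology Literature.Probability.LatticeModels

section LimitKernel

variable {G : Site 3 → ℝ} {C s : ℝ}

/-- A lattice point is its own lattice approximation at any scale `M ≥ 1`: `⌊M · (M⁻¹ x)⌋ = x`. -/
theorem latticeApprox_inv_smul_siteVec {M : ℕ} (hM : 0 < M) (x : Site 3) :
    latticeApprox ((M : ℝ)⁻¹) (((M : ℝ)⁻¹) • siteVec x) = x := by
  funext i
  simp only [latticeApprox_apply, PiLp.smul_apply, smul_eq_mul, siteVec_apply]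
  have hM' : (M : ℝ) ≠ 0 := by exact_mod_cast hM.ne'
  rw [show (M : ℝ)⁻¹ * (x i : ℝ) / (M : ℝ)⁻¹ = (x i : ℝ) by field_simp]
  exact Int.floor_intCast (x i)

/-- **Uniformity of the ray limits in the direction.**  If `G` is Lipschitz at scale, `N^s G(⌊Nw⌋) → k(w)`
for every `w ≠ 0`, and `k(c y) = c^{-s} k(y)`, then `G(x)‖x‖₂^s − k(x/‖x‖₂) → 0` along the cofinite filter
of `ℤ³`.  Proof: write `x = ⌊M v⌋` with `M = ⌊‖x‖₂⌋`, `1 ≤ ‖v‖₂ ≤ 2`; compare the ray through `v` with the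
ray through the nearest point `w` of a finite `1/L`-net (`ray_compare`), use the convergence at the finitely
many net points, and the Lipschitz continuity of `k` (`rayLimit_lipschitz`). -/
theorem tendsto_cofinite_of_rayLimits (hs : 0 < s) (hC : 0 ≤ C)
    (hLip : ∀ z z' : Site 3, 16 ≤ ‖z‖ → (∑ l, |((z' l - z l : ℤ) : ℝ)|) ≤ ‖z‖ / 2 →
      |G z' - G z| ≤ C * (∑ l, |((z' l - z l : ℤ) : ℝ)|) * ‖z‖ ^ (-(s + 1)))
    {k : EuclideanSpace ℝ (Fin 3) → ℝ}
    (hk : ∀ w : EuclideanSpace ℝ (Fin 3), w ≠ 0 →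
      Tendsto (fun N : ℕ => (N : ℝ) ^ s * G (latticeApprox ((N : ℝ)⁻¹) w)) atTop (𝓝 (k w)))
    (hhom : ∀ c : ℝ, 0 < c → ∀ y, y ≠ 0 → k (c • y) = c ^ (-s) * k y) :
    Tendsto (fun x : Site 3 => G x * ‖siteVec x‖ ^ s - k (‖siteVec x‖⁻¹ • siteVec x))
      cofinite (𝓝 0) := by
  -- the Lipschitz constant at `ρ = 1/2`
  set K₁ : ℝ := 3 * C * (8 / (1 / 2 : ℝ)) ^ (s + 1) with hK₁
  have hK₁0 : 0 ≤ K₁ := by positivity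
  rw [Metric.tendsto_nhds]
  intro ε hε
  have h2s : (0 : ℝ) < 2 ^ s := Real.rpow_pos_of_pos two_pos s
  set e : ℝ := ε / (4 * 2 ^ s) with he
  have he0 : 0 < e := by positivity
  -- the net fineness `L`
  obtain ⟨L, hL⟩ := exists_nat_ge (max 192 (4 * K₁ / e))
  have hL192 : (192 : ℝ) ≤ L := (le_max_left _ _).trans hL
  have hLpos : (0 : ℝ) < L := by linarith
  have hLe : 4 * K₁ / L ≤ e := by
    have h : 4 * K₁ / e ≤ L := (le_max_right _ _).trans hL
    rw [div_le_iff₀ hLpos]; rw [div_le_iff₀ he0] at h; linarith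
  -- the net: `wt t = L⁻¹ • t` for `t ∈ box 3 (2 L + 1)`
  set wt : Site 3 → EuclideanSpace ℝ (Fin 3) := fun t => ((L : ℝ)⁻¹) • siteVec t with hwt
  have hwt_t : ∀ t, wt t = ((L : ℝ)⁻¹) • siteVec t := fun t => rfl
  -- convergence at the finitely many net points, simultaneously
  have hnet : ∀ᶠ N : ℕ in atTop, ∀ t ∈ box 3 (2 * L + 1), wt t ≠ 0 →
      |(N : ℝ) ^ s * G (latticeApprox ((N : ℝ)⁻¹) (wt t)) - k (wt t)| < e := by
    refine (Filter.eventually_all_finset _).2 fun t _ => ?_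
    by_cases ht : wt t = 0
    · exact Eventually.of_forall fun N h => absurd ht h
    · filter_upwards [(Metric.tendsto_nhds.1 (hk _ ht)) e he0] with N hN _
      rwa [Real.dist_eq] at hN
  obtain ⟨N₁, hN₁⟩ := eventually_atTop.1 hnet
  obtain ⟨M₁, hM₁⟩ := exists_nat_ge (4 * K₁ / e)
  -- the threshold: `‖x‖ ≥ M₀ + 1`
  set M₀ : ℕ := max N₁ (max 400 M₁) with hM₀
  have hev : ∀ᶠ x : Site 3 in cofinite, ((M₀ : ℝ) + 1) ≤ ‖x‖ :=
    Site.tendsto_norm_cofinite_atTop.eventually_ge_atTop _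
  filter_upwards [hev] with x hx
  rw [Real.dist_eq, sub_zero]
  -- the scale `M = ⌊‖x‖₂⌋` and the rescaled point `v = x / M`, `1 ≤ ‖v‖ ≤ 2`
  have hxv : ((M₀ : ℝ) + 1) ≤ ‖siteVec x‖ := hx.trans (norm_le_norm_siteVec x)
  set M : ℕ := ⌊‖siteVec x‖⌋₊ with hM
  have hMle : (M : ℝ) ≤ ‖siteVec x‖ := Nat.floor_le (norm_nonneg _)
  have hMlt : ‖siteVec x‖ < (M : ℝ) + 1 := Nat.lt_floor_add_one _
  have hM₀M : M₀ ≤ M := by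
    rw [hM]; apply Nat.le_floor; linarith
  have hN₁M : N₁ ≤ M := le_trans (le_max_left _ _) hM₀M
  have hM400 : (400 : ℝ) ≤ M := by
    have h : (400 : ℕ) ≤ M := le_trans ((le_max_left _ _).trans (le_max_right _ _)) hM₀M
    exact_mod_cast h
  have hM₁M : (M₁ : ℝ) ≤ M := by
    have h : M₁ ≤ M := le_trans ((le_max_right _ _).trans (le_max_right _ _)) hM₀M
    exact_mod_cast h
  have hMpos : (0 : ℝ) < M := by linarith
  have hM0 : (M : ℝ) ≠ 0 := hMpos.ne'
  have hMnat : 0 < M := by exact_mod_cast hMpos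
  have hMe : 4 * K₁ / M ≤ e := by
    have h : 4 * K₁ / e ≤ M := hM₁.trans hM₁M
    rw [div_le_iff₀ hMpos]; rw [div_le_iff₀ he0] at h; linarith
  set v : EuclideanSpace ℝ (Fin 3) := ((M : ℝ)⁻¹) • siteVec x with hv
  have hxv_eq : siteVec x = (M : ℝ) • v := by
    rw [hv, smul_smul, mul_inv_cancel₀ hM0, one_smul]
  have hnv : ‖siteVec x‖ = (M : ℝ) * ‖v‖ := by
    rw [hxv_eq, norm_smul, Real.norm_natCast]
  have hv1 : 1 ≤ ‖v‖ :=
    le_of_mul_le_mul_left (by rw [mul_one, ← hnv]; exact hMle : (M : ℝ) * 1 ≤ M * ‖v‖) hMpos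
  have hv2 : ‖v‖ ≤ 2 :=
    le_of_mul_le_mul_left (by rw [← hnv]; linarith : (M : ℝ) * ‖v‖ ≤ M * 2) hMpos
  have hvpos : 0 < ‖v‖ := by linarith
  have hv0 : v ≠ 0 := norm_pos_iff.1 hvpos
  have hxM : latticeApprox ((M : ℝ)⁻¹) v = x := latticeApprox_inv_smul_siteVec hMnat x
  -- the nearest net point `wt t`, `t = ⌊L v⌋`
  obtain ⟨t, ht⟩ : ∃ t : Site 3, t = latticeApprox ((L : ℝ)⁻¹) v := ⟨_, rfl⟩
  have hvw : ‖v - wt t‖ ≤ 2 / L := by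
    have h1 : ‖siteVec t - (L : ℝ) • v‖ ≤ 2 := by rw [ht]; exact norm_siteVec_latticeApprox_sub_le L v
    have h2 : v - wt t = ((L : ℝ)⁻¹) • ((L : ℝ) • v - siteVec t) := by
      rw [hwt_t, smul_sub, smul_smul, inv_mul_cancel₀ hLpos.ne', one_smul]
    rw [h2, norm_smul, norm_inv, Real.norm_natCast, norm_sub_rev, div_eq_inv_mul]
    exact mul_le_mul_of_nonneg_left h1 (inv_nonneg.2 hLpos.le)
  have h2L : (2 : ℝ) / L ≤ 2 / 192 := div_le_div_of_nonneg_left (by norm_num) (by norm_num) hL192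
  have hvw' : ‖v - wt t‖ ≤ 1 / 2 / 48 := by linarith
  have hw_half : (1 / 2 : ℝ) ≤ ‖wt t‖ := by
    have h := norm_sub_norm_le v (wt t)
    linarith
  have hw0 : wt t ≠ 0 := norm_pos_iff.1 (by linarith)
  have htmem : t ∈ box 3 (2 * L + 1) := by
    rw [mem_box]
    intro i
    have hvi : |v i| ≤ 2 := by
      have h := PiLp.norm_apply_le v i
      rw [Real.norm_eq_abs] at h
      exact h.trans hv2
    have hlo : -2 ≤ v i := (abs_le.1 hvi).1
    have hhi : v i ≤ 2 := (abs_le.1 hvi).2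
    have hti : t i = ⌊v i * L⌋ := by rw [ht, latticeApprox_apply, div_inv_eq_mul]
    rw [hti]
    constructor
    · rw [Int.le_floor]; push_cast; nlinarith
    · rw [Int.floor_le_iff]; push_cast; nlinarith
  -- the three comparisons
  have hM200 : (200 : ℝ) ≤ (M : ℝ) * (1 / 2) := by linarith
  have hA : |(M : ℝ) ^ s * G x - (M : ℝ) ^ s * G (latticeApprox ((M : ℝ)⁻¹) (wt t))|
      ≤ K₁ * (‖v - wt t‖ + 4 / M) := by
    have h := ray_compare hs hC hLip (ρ := 1 / 2) (by norm_num) hw_half hvw' hM200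
    rw [hxM] at h
    rw [← mul_sub, abs_mul, abs_of_nonneg (Real.rpow_nonneg hMpos.le _)]
    exact h
  have hB : |(M : ℝ) ^ s * G (latticeApprox ((M : ℝ)⁻¹) (wt t)) - k (wt t)| < e :=
    hN₁ M hN₁M t htmem hw0
  have hCk : |k v - k (wt t)| ≤ K₁ * ‖v - wt t‖ :=
    rayLimit_lipschitz hs hC hLip (ρ := 1 / 2) (by norm_num) hw_half hvw' (hk _ hw0) (hk v hv0)
  have hmain : |(M : ℝ) ^ s * G x - k v| ≤ 3 * e := by
    have htri : |(M : ℝ) ^ s * G x - k v|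
        ≤ |(M : ℝ) ^ s * G x - (M : ℝ) ^ s * G (latticeApprox ((M : ℝ)⁻¹) (wt t))|
          + |(M : ℝ) ^ s * G (latticeApprox ((M : ℝ)⁻¹) (wt t)) - k (wt t)| + |k (wt t) - k v| := by
      have h1 := abs_sub_le ((M : ℝ) ^ s * G x) ((M : ℝ) ^ s * G (latticeApprox ((M : ℝ)⁻¹) (wt t))) (k v)
      have h2 := abs_sub_le ((M : ℝ) ^ s * G (latticeApprox ((M : ℝ)⁻¹) (wt t))) (k (wt t)) (k v)
      linarith
    rw [abs_sub_comm] at hCk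
    have h1 : K₁ * ‖v - wt t‖ ≤ K₁ * (2 / L) := mul_le_mul_of_nonneg_left hvw hK₁0
    have h2 : K₁ * (4 / (M : ℝ)) = 4 * K₁ / M := by ring
    have h3 : K₁ * (2 / (L : ℝ)) * 2 = 4 * K₁ / L := by ring
    have h4 : K₁ * (‖v - wt t‖ + 4 / M) = K₁ * ‖v - wt t‖ + K₁ * (4 / M) := mul_add _ _ _
    linarith
  -- back to `x`
  have hdir : ‖siteVec x‖⁻¹ • siteVec x = ‖v‖⁻¹ • v := by
    rw [hnv, hxv_eq, smul_smul, mul_inv_rev, inv_mul_cancel_right₀ hM0]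
  have hkdir : k (‖v‖⁻¹ • v) = ‖v‖ ^ s * k v := by
    rw [hhom _ (inv_pos.2 hvpos) v hv0, Real.rpow_neg (inv_nonneg.2 hvpos.le),
      Real.inv_rpow hvpos.le, inv_inv]
  have hGx : G x * ‖siteVec x‖ ^ s = ‖v‖ ^ s * ((M : ℝ) ^ s * G x) := by
    rw [hnv, Real.mul_rpow hMpos.le hvpos.le]; ring
  rw [hdir, hkdir, hGx, ← mul_sub, abs_mul, abs_of_nonneg (Real.rpow_nonneg hvpos.le _)]
  have hvs : ‖v‖ ^ s ≤ 2 ^ s := Real.rpow_le_rpow hvpos.le hv2 hs.le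
  have h2s' : (2 : ℝ) ^ s ≠ 0 := h2s.ne'
  have hfin : (2 : ℝ) ^ s * (3 * e) = 3 / 4 * ε := by
    rw [he]; field_simp
  calc ‖v‖ ^ s * |(M : ℝ) ^ s * G x - k v| ≤ 2 ^ s * (3 * e) :=
        mul_le_mul hvs hmain (abs_nonneg _) h2s.le
    _ = 3 / 4 * ε := hfin
    _ < ε := by linarith

/-- **The limit kernel.**  If `G` is Lipschitz at scale (constants `C ≥ 0`, `s > 0`), has block scaling
limits around every ray, and `G(z) ≥ c₀‖z‖^{-s}` off the origin, then there is `U : ℝ³ → ℝ`, continuous on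
`ℝ³ ∖ {0}`, positive off `0`, homogeneous of degree `-s`, with `G(x)‖x‖₂^s − U(x/‖x‖₂) → 0` at infinity
on `ℤ³`. -/
theorem exists_limit_kernel (hs : 0 < s) (hC : 0 ≤ C)
    (hLip : ∀ z z' : Site 3, 16 ≤ ‖z‖ → (∑ l, |((z' l - z l : ℤ) : ℝ)|) ≤ ‖z‖ / 2 →
      |G z' - G z| ≤ C * (∑ l, |((z' l - z l : ℤ) : ℝ)|) * ‖z‖ ^ (-(s + 1)))
    (hΛ : ∀ w : EuclideanSpace ℝ (Fin 3), w ≠ 0 → ∀ δ : ℝ, 0 < δ → ∃ Λ : ℝ,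
      Tendsto (fun N : ℕ => (N : ℝ) ^ (s - 6) *
        ∑ u ∈ box 3 ⌊δ * N⌋₊, ∑ u' ∈ box 3 ⌊δ * N⌋₊, G (latticeApprox ((N : ℝ)⁻¹) w + u - u'))
        atTop (𝓝 Λ))
    {c₀ : ℝ} (hc₀ : 0 < c₀) (hlo : ∀ z : Site 3, z ≠ 0 → c₀ * ‖z‖ ^ (-s) ≤ G z) :
    ∃ U : EuclideanSpace ℝ (Fin 3) → ℝ, ContinuousOn U {0}ᶜ ∧ (∀ y, y ≠ 0 → 0 < U y) ∧
      (∀ c : ℝ, 0 < c → ∀ y, U (c • y) = c ^ (-s) * U y) ∧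
      Tendsto (fun x : Site 3 => G x * ‖siteVec x‖ ^ s - U (‖siteVec x‖⁻¹ • siteVec x))
        cofinite (𝓝 0) := by
  classical
  -- the ray limits `k`
  set k : EuclideanSpace ℝ (Fin 3) → ℝ := fun w =>
    limUnder atTop (fun N : ℕ => (N : ℝ) ^ s * G (latticeApprox ((N : ℝ)⁻¹) w)) with hkdef
  have hk : ∀ w : EuclideanSpace ℝ (Fin 3), w ≠ 0 →
      Tendsto (fun N : ℕ => (N : ℝ) ^ s * G (latticeApprox ((N : ℝ)⁻¹) w)) atTop (𝓝 (k w)) :=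
    fun w hw => tendsto_nhds_limUnder (ray_limit hs hC hLip hw (hΛ w hw))
  have hhom : ∀ c : ℝ, 0 < c → ∀ y, y ≠ 0 → k (c • y) = c ^ (-s) * k y :=
    fun c hc y hy => rayLimit_homogeneous hs hC hLip hk hy hc
  have hpos : ∀ y, y ≠ 0 → 0 < k y := fun y hy => by
    have hyn : 0 < ‖y‖ := norm_pos_iff.2 hy
    exact lt_of_lt_of_le (mul_pos hc₀ (Real.rpow_pos_of_pos (by positivity) _))
      (rayLimit_pos hs hc₀ hlo hy (hk y hy))
  set U : EuclideanSpace ℝ (Fin 3) → ℝ := fun y => if y = 0 then 0 else k y with hU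
  have hUk : ∀ y, y ≠ 0 → U y = k y := fun y hy => if_neg hy
  refine ⟨U, ?_, ?_, ?_, ?_⟩
  · -- continuity off the origin, from the Lipschitz bound
    intro y hy
    have hy0 : y ≠ 0 := hy
    rw [Metric.continuousWithinAt_iff]
    intro ε hε
    have hρ0 : 0 < ‖y‖ := norm_pos_iff.2 hy0
    set Kρ : ℝ := 3 * C * (8 / ‖y‖) ^ (s + 1) with hKρ
    have hKρ0 : 0 ≤ Kρ := by positivity
    refine ⟨min (‖y‖ / 48) (ε / (Kρ + 1)), lt_min (by positivity) (by positivity), ?_⟩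
    intro y' hy' hd
    have hy'0 : y' ≠ 0 := hy'
    rw [hUk y hy0, hUk y' hy'0, Real.dist_eq]
    rw [dist_eq_norm] at hd
    have hle := rayLimit_lipschitz hs hC hLip hρ0 (le_refl ‖y‖) ((min_le_left _ _).trans' hd.le)
      (hk y hy0) (hk y' hy'0)
    calc |k y' - k y| ≤ Kρ * ‖y' - y‖ := hle
      _ ≤ Kρ * (ε / (Kρ + 1)) := mul_le_mul_of_nonneg_left ((min_le_right _ _).trans' hd.le) hKρ0
      _ < ε := by rw [mul_div_assoc', div_lt_iff₀ (by positivity)]; nlinarith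
  · intro y hy
    rw [hUk y hy]
    exact hpos y hy
  · intro c hc y
    by_cases hy : y = 0
    · simp [hU, hy]
    · rw [hUk y hy, hUk _ (smul_ne_zero hc.ne' hy)]
      exact hhom c hc y hy
  · refine (tendsto_cofinite_of_rayLimits hs hC hLip hk hhom).congr' ?_
    filter_upwards [eventually_cofinite_ne (0 : Site 3)] with x hx
    have hsx : siteVec x ≠ 0 := fun h => hx ((siteVec_eq_zero_iff x).1 h)
    rw [hUk _ (smul_ne_zero (inv_ne_zero (norm_ne_zero_iff.2 hsx)) hsx)]

end LimitKernel

end Summit.CriticalPhenomena.Ising3DConformalLimit.Theorems.SpineGlue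

end
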